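import Literature.Analysis.FluidPDE.VortexStretchingDynamics
import Mathlib.Analysis.InnerProductSpace.Calculus
import HarnessLib

/-!
# The pointwise helicity-density transport identity on `ℝ³`:
# `∂ₜ(u·ω) + div[(u·ω)u + (p − ½|u|²)ω] = ν(Δu·ω + u·Δω)` (Majda–Bertozzi Prop. 1.12 (iv); Moffatt–Tsinober)

Analysis/FluidPDE proof file (theorems only; no definitions, no named facts): the whole-space,
POINTWISE form of the helicity-density conservation law, companion of the torus file
`TorusHelicityDensityTransport.lean` (`Torus.IsClassicalNSSolutionOn.timeDerivWithin_helicityDensity_add_sum_partialDeriv_flux`)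
and of the global `ℝ³` balance `IsClassicalNSSolutionOn.hasDerivWithinAt_helicity`
(`Superhelicity.lean`, which needs uniform rapid decay). Here no decay and no global hypothesis is
used: the identity holds at one point `(t, x)` from the momentum and vorticity equations AT THAT
POINT — which is what a windowed (cut-off) helicity budget on `ℝ³` needs (nsreg-p1 S20 B3,
nsreg-lit §R72 (C): "the pointwise computation is domain-free; only the IBP against `χ_R` changes").

## What is printed

A. J. Majda, A. L. Bertozzi, *Vorticity and Incompressible Flow* (CUP 2002), §1.6, proof of
Prop. 1.12 (iv) (conservation of helicity), p. 24, verbatim: "`(v·ω)_t + div[v(v·ω) + ω(p − ½v²)] = 0`"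
(smooth Euler flows); for Navier–Stokes the same computation leaves the viscous sources
`ν(Δv·ω + v·Δω)` — the "viscous destruction of helicity" of Moffatt–Tsinober, Annu. Rev. Fluid
Mech. 24 (1992) 281–312, §2.

## What is here (pointwise at `(t, x)`; `ω = curl u`)

Hypotheses: the slice `u(t,·)` is `C²` at `x` (so that `ω(t,·)` is differentiable at `x` and
`div ω(t, x) = 0`), `p(t,·)` is differentiable at `x`, `div u(t, x) = 0`, the momentum equation
`∂ₜu = νΔu − (u·∇)u − ∇p` holds at `(t, x)` and the classical vorticity equation
`∂ₜω = νΔω − (u·∇)ω + (ω·∇)u` holds at `(t, x)` (the shapes of `IsClassicalNSSolutionOn.momentum`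
and `IsLerayHopfOn.vorticity_classical_of_contDiffOn`).

* `divergence_curl_eq_zero_of_contDiffAt` — `div (curl v)(x) = 0` for `v` of class `C²` at `x`
  (pointwise form of the tree's global `divergence_curl_eq_zero`; symmetry of `D²v(x)`);
* `divergence_helicityFlux` — the divergence of the flux,
  `div[(u·ω)u + (p − ½|u|²)ω](x) = ⟪∇u u, ω⟫ + ⟪u, ∇ω u⟫ + ⟪∇p, ω⟫ − ⟪u, ∇u ω⟫`
  (`div u = div ω = 0`);
* **`hasDerivAt_helicityDensity`** — the law: `∂ₜ⟪u, ω⟫ = −div[(u·ω)u + (p − ½|u|²)ω] + ν(⟪Δu, ω⟫ + ⟪u, Δω⟫)`;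
* **`hasDerivAt_helicityDensity_euler`** — `ν = 0`: `(v·ω)_t + div[v(v·ω) + ω(p − ½v²)] = 0` as printed.

WHAT THIS IS NOT: no integrated/windowed budget (that is one integration by parts against a cut-off
away — `WholeSpaceIBP`/`DifferentiableGaussGreen` — and is left to the consumer), no regularity claim.

## Tree / Mathlib search

Tree (used): `curl`, `curlCLM`, `curlCLM_apply`, `curl_eq_curlCLM_comp`, `convect_apply`,
`VectorCalculus.divergence`, `divergence_eq_sum_inner_fderiv`. Mathlib: `HasDerivAt.inner`,
`HasFDerivAt.inner`, `HasFDerivAt.norm_sq`, `fderiv_fun_smul`, `ContDiffAt.isSymmSndFDerivAt`,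
`InnerProductSpace.toDual_symm_apply`. Searched: `helicityDensity` (torus only:
`TorusHelicityDensityTransport`, `HelicityDensityPseudoscalar` = parity), `divergence_curl` (global
`ContDiff` forms only), `divergence_smul_apply` (`WholeSpaceIBP`, re-proved here privately to keep the
imports light).

## References

* A. J. Majda, A. L. Bertozzi, *Vorticity and Incompressible Flow*, CUP 2002, §1.6 Prop. 1.12 (iv)
  and its proof, p. 24. [`MajdaBertozziCUP2002`]
* H. K. Moffatt, A. Tsinober, *Helicity in laminar and turbulent flow*, Annu. Rev. Fluid Mech. 24
  (1992) 281–312, §2 (viscous helicity balance). [`MoffattTsinober1992`]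
-/

noncomputable section

open Set Function Filter InnerProductSpace
open scoped RealInnerProductSpace Topology Laplacian

namespace Literature.Analysis.FluidPDE

namespace HelicityDensityTransport

/-! ### Pointwise Leibniz rules -/

section Pointwise

variable {E : Type*} [NormedAddCommGroup E] [InnerProductSpace ℝ E] [FiniteDimensional ℝ E]

/-- Leibniz rule `div(θ u) = θ div u + ∇θ·u` at a point (re-proved from `WholeSpaceIBP` to keep the
imports of this file light). [folklore] -/
private theorem divergence_smul_apply' {θ : E → ℝ} {u : E → E} {x : E} (hθ : DifferentiableAt ℝ θ x)
    (hu : DifferentiableAt ℝ u x) :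
    VectorCalculus.divergence (fun y => θ y • u y) x =
      θ x * VectorCalculus.divergence u x + fderiv ℝ θ x (u x) := by
  let b := stdOrthonormalBasis ℝ E
  rw [divergence_eq_sum_inner_fderiv b, divergence_eq_sum_inner_fderiv b, fderiv_fun_smul hθ hu,
    Finset.mul_sum]
  simp only [_root_.add_apply, _root_.FunLike.coe_smul, Pi.smul_apply,
    ContinuousLinearMap.smulRight_apply, inner_add_right, Finset.sum_add_distrib,
    real_inner_smul_right]
  congr 1
  calc ∑ i, fderiv ℝ θ x (b i) * ⟪b i, u x⟫
      = fderiv ℝ θ x (∑ i, ⟪b i, u x⟫ • b i) := by simp [mul_comm]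
    _ = fderiv ℝ θ x (u x) := by rw [b.sum_repr']

omit [FiniteDimensional ℝ E] in
/-- `div (v + w) = div v + div w` at a point. [folklore] -/
private theorem divergence_add_apply' {v w : E → E} {x : E} (hv : DifferentiableAt ℝ v x)
    (hw : DifferentiableAt ℝ w x) :
    VectorCalculus.divergence (fun y => v y + w y) x =
      VectorCalculus.divergence v x + VectorCalculus.divergence w x := by
  simp only [VectorCalculus.divergence, fderiv_fun_add hv hw, ContinuousLinearMap.toLinearMap_add,
    map_add]

end Pointwise

/-! ### `div curl = 0` at a point -/

/-- **`div (curl v)(x) = 0`** for `v : ℝ³ → ℝ³` of class `C²` at `x` — the pointwise form of the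
vector identity `div curl = 0` (symmetry of the second derivative `D²v(x)`).
[cite: MajdaBertozziCUP2002, §1.1 (vector identities); cf. §2.4.1 eq. (2.96)] -/
theorem divergence_curl_eq_zero_of_contDiffAt {v : EuclideanSpace ℝ (Fin 3) → EuclideanSpace ℝ (Fin 3)}
    {x : EuclideanSpace ℝ (Fin 3)} (hv : ContDiffAt ℝ 2 v x) :
    VectorCalculus.divergence (curl v) x = 0 := by
  have hA : DifferentiableAt ℝ (fderiv ℝ v) x :=
    (hv.fderiv_right (m := 1) (by norm_num)).differentiableAt (by simp)
  have hsym : IsSymmSndFDerivAt ℝ v x :=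
    hv.isSymmSndFDerivAt (by simp only [minSmoothness_of_isRCLikeNormedField]; exact le_rfl)
  have hD : fderiv ℝ (curl v) x = curlCLM.comp (fderiv ℝ (fderiv ℝ v) x) := by
    rw [curl_eq_curlCLM_comp]
    exact (curlCLM.hasFDerivAt.comp x hA.hasFDerivAt).fderiv
  rw [divergence_eq_sum_inner_fderiv (EuclideanSpace.basisFun (Fin 3) ℝ), Fin.sum_univ_three, hD]
  simp only [EuclideanSpace.basisFun_apply, ContinuousLinearMap.comp_apply, curlCLM_apply,
    EuclideanSpace.inner_single_left, map_one, one_mul, Matrix.cons_val_zero,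
    Matrix.cons_val_one, Matrix.cons_val_two, Matrix.head_cons, Matrix.tail_cons]
  have h10 := congrArg (fun w : EuclideanSpace ℝ (Fin 3) => w.ofLp 2)
    (hsym (EuclideanSpace.single 1 1) (EuclideanSpace.single 0 1))
  have h20 := congrArg (fun w : EuclideanSpace ℝ (Fin 3) => w.ofLp 1)
    (hsym (EuclideanSpace.single 2 1) (EuclideanSpace.single 0 1))
  have h21 := congrArg (fun w : EuclideanSpace ℝ (Fin 3) => w.ofLp 0)
    (hsym (EuclideanSpace.single 2 1) (EuclideanSpace.single 1 1))
  simp only at h10 h20 h21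
  linarith

/-! ### The helicity-density law -/

section Law

variable {u : ℝ → EuclideanSpace ℝ (Fin 3) → EuclideanSpace ℝ (Fin 3)}
  {p : ℝ → EuclideanSpace ℝ (Fin 3) → ℝ} {x : EuclideanSpace ℝ (Fin 3)} {t ν : ℝ}

/-- **The divergence of the helicity flux**: for `u(t,·)` of class `C²` at `x` with `div u(t,x) = 0`
and `p(t,·)` differentiable at `x`,
`div[(u·ω)u + (p − ½|u|²)ω](x) = ⟪∇u u, ω⟫ + ⟪u, ∇ω u⟫ + ⟪∇p, ω⟫ − ⟪u, ∇u ω⟫`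
(`½|u|²` written `(1/2)‖u‖²`; `div u = 0`, `div ω = 0`, `∇(u·ω)·u = ⟪∇u u, ω⟫ + ⟪u, ∇ω u⟫`, `∇(½|u|²)·ω = ⟪u, ∇u ω⟫`).
[cite: MajdaBertozziCUP2002, §1.6, proof of Prop. 1.12 (iv), p. 24] -/
theorem divergence_helicityFlux (hut : ContDiffAt ℝ 2 (u t) x) (hp : DifferentiableAt ℝ (p t) x)
    (hdiv : VectorCalculus.divergence (u t) x = 0) :
    VectorCalculus.divergence
        (fun y => ⟪u t y, curl (u t) y⟫ • u t y + (p t y - (1 / 2) * ‖u t y‖ ^ 2) • curl (u t) y) x =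
      ⟪fderiv ℝ (u t) x (u t x), curl (u t) x⟫ + ⟪u t x, fderiv ℝ (curl (u t)) x (u t x)⟫ +
        ⟪gradient (p t) x, curl (u t) x⟫ - ⟪u t x, fderiv ℝ (u t) x (curl (u t) x)⟫ := by
  have hA1 : DifferentiableAt ℝ (fderiv ℝ (u t)) x :=
    (hut.fderiv_right (m := 1) (by norm_num)).differentiableAt (by simp)
  have hud : DifferentiableAt ℝ (u t) x := hut.differentiableAt (by simp)
  have hωd : DifferentiableAt ℝ (curl (u t)) x := by
    rw [curl_eq_curlCLM_comp]
    exact curlCLM.differentiableAt.comp x hA1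
  -- the two scalar densities and their derivatives along a vector
  have hθ₁ : HasFDerivAt (fun y => ⟪u t y, curl (u t) y⟫)
      ((fderivInnerCLM ℝ (u t x, curl (u t) x)).comp
        ((fderiv ℝ (u t) x).prod (fderiv ℝ (curl (u t)) x))) x :=
    hud.hasFDerivAt.inner ℝ hωd.hasFDerivAt
  have hθ₂ : HasFDerivAt (fun y => p t y - (1 / 2) * ‖u t y‖ ^ 2)
      (fderiv ℝ (p t) x - (1 / 2 : ℝ) • (2 • (innerSL ℝ (u t x)).comp (fderiv ℝ (u t) x))) x :=
    hp.hasFDerivAt.sub (hud.hasFDerivAt.norm_sq.const_mul (1 / 2 : ℝ))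
  have hdivω : VectorCalculus.divergence (curl (u t)) x = 0 := divergence_curl_eq_zero_of_contDiffAt hut
  have hd1 : DifferentiableAt ℝ (fun y => ⟪u t y, curl (u t) y⟫ • u t y) x :=
    hθ₁.differentiableAt.smul hud
  have hd2 : DifferentiableAt ℝ (fun y => (p t y - (1 / 2) * ‖u t y‖ ^ 2) • curl (u t) y) x :=
    hθ₂.differentiableAt.smul hωd
  rw [divergence_add_apply' hd1 hd2,
    divergence_smul_apply' hθ₁.differentiableAt hud, divergence_smul_apply' hθ₂.differentiableAt hωd,
    hdiv, hdivω, mul_zero, mul_zero, zero_add, zero_add, hθ₁.fderiv, hθ₂.fderiv]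
  simp only [ContinuousLinearMap.comp_apply, ContinuousLinearMap.prod_apply, fderivInnerCLM_apply,
    sub_apply, smul_apply, innerSL_apply_apply, nsmul_eq_mul, Nat.cast_ofNat, smul_eq_mul]
  rw [show fderiv ℝ (p t) x (curl (u t) x) = ⟪gradient (p t) x, curl (u t) x⟫ by
    rw [gradient, InnerProductSpace.toDual_symm_apply]]
  ring

/-- **The helicity-density transport law on `ℝ³`, pointwise** (Navier–Stokes): under the hypotheses
above plus the momentum equation `∂ₜu = νΔu − (u·∇)u − ∇p` at `(t, x)` and the vorticity equation
`∂ₜω = νΔω − (u·∇)ω + (ω·∇)u` at `(t, x)`,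
`∂ₜ⟪u, ω⟫ = −div[(u·ω)u + (p − ½|u|²)ω] + ν(⟪Δu, ω⟫ + ⟪u, Δω⟫)` at `(t, x)` — the printed
`(v·ω)_t + div[v(v·ω) + ω(p − ½v²)] = 0` with the viscous sources ("viscous destruction of
helicity") on the right.
[cite: MajdaBertozziCUP2002, §1.6, proof of Prop. 1.12 (iv), p. 24]
[cite: MoffattTsinober1992, §2 (viscous helicity balance)] -/
theorem hasDerivAt_helicityDensity (hut : ContDiffAt ℝ 2 (u t) x) (hp : DifferentiableAt ℝ (p t) x)
    (hdiv : VectorCalculus.divergence (u t) x = 0)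
    (hmom : HasDerivAt (fun s => u s x)
      (ν • Δ (u t) x - convect (u t) (u t) x - gradient (p t) x) t)
    (hvort : HasDerivAt (fun s => curl (u s) x)
      (ν • Δ (curl (u t)) x - convect (u t) (curl (u t)) x + convect (curl (u t)) (u t) x) t) :
    HasDerivAt (fun s => ⟪u s x, curl (u s) x⟫)
      (-VectorCalculus.divergence
          (fun y => ⟪u t y, curl (u t) y⟫ • u t y + (p t y - (1 / 2) * ‖u t y‖ ^ 2) • curl (u t) y) x +
        ν * (⟪Δ (u t) x, curl (u t) x⟫ + ⟪u t x, Δ (curl (u t)) x⟫)) t := by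
  refine (hmom.inner ℝ hvort).congr_deriv ?_
  rw [divergence_helicityFlux hut hp hdiv, convect_apply, convect_apply, convect_apply]
  simp only [inner_add_right, inner_sub_left, inner_sub_right, inner_smul_left, inner_smul_right,
    RCLike.conj_to_real]
  ring

/-- **Euler (`ν = 0`), as printed: `(v·ω)_t + div[v(v·ω) + ω(p − ½v²)] = 0`** at `(t, x)`.
[cite: MajdaBertozziCUP2002, §1.6, proof of Prop. 1.12 (iv), p. 24] -/
theorem hasDerivAt_helicityDensity_euler (hut : ContDiffAt ℝ 2 (u t) x)
    (hp : DifferentiableAt ℝ (p t) x) (hdiv : VectorCalculus.divergence (u t) x = 0)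
    (hmom : HasDerivAt (fun s => u s x) (-convect (u t) (u t) x - gradient (p t) x) t)
    (hvort : HasDerivAt (fun s => curl (u s) x)
      (-convect (u t) (curl (u t)) x + convect (curl (u t)) (u t) x) t) :
    HasDerivAt (fun s => ⟪u s x, curl (u s) x⟫)
      (-VectorCalculus.divergence
          (fun y => ⟪u t y, curl (u t) y⟫ • u t y + (p t y - (1 / 2) * ‖u t y‖ ^ 2) • curl (u t) y) x) t := by
  have hmom' : HasDerivAt (fun s => u s x)
      ((0 : ℝ) • Δ (u t) x - convect (u t) (u t) x - gradient (p t) x) t := by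
    rwa [zero_smul, zero_sub]
  have hvort' : HasDerivAt (fun s => curl (u s) x)
      ((0 : ℝ) • Δ (curl (u t)) x - convect (u t) (curl (u t)) x + convect (curl (u t)) (u t) x) t := by
    rwa [zero_smul, zero_sub]
  have h := hasDerivAt_helicityDensity hut hp hdiv hmom' hvort'
  rwa [zero_mul, add_zero] at h

end Law

end HelicityDensityTransport

end Literature.Analysis.FluidPDE
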